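import Mathlib
import HarnessLib
import Summits.Ventures.LatticeQCDFlow.Scoring.ChainBlockSumMoments
import Summits.Ventures.LatticeQCDFlow.Exactness.NCMCGeneralSpaceDoeblinPowerPoisson

/-!
# Block sums of a chain with a GEOMETRIC SUP-NORM ENVELOPE, from any start:
# `E_{μ₀}[(Σ_{t<n} f̄(X_{s+t}))⁴] ≤ 512 C_h⁴ n²`, `|E_{μ₀}[(Σ_{t<n} f̄(X_{s+t}))²] − n σ²_f| ≤ C_h² (2A/(1−ρ) + 4 + 4√n)`
# with `C_h = 4 C A/(1−ρ)`, and `0 ≤ σ²_f ≤ C_h²`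

HONEST FRAMING: exact (Metropolis-corrected) sampling algorithms for lattice gauge theory;
figures of merit are autocorrelation/cost numbers at stated couplings and volumes; no
continuum-physics claim.

Venture `LatticeQCDFlow` (cell pub-lqcd), topic `Scoring`; FANOUT row 8 (`s0-cpn-nemc`, GEN-20).
NEW WORK of the cell, not a published result; no definition is introduced; nothing is cited as a
fact.  Setting: `κ` a Markov kernel with an invariant probability law `π` and a GEOMETRIC SUP-NORM
ENVELOPE `|(kop κ)^[t] g (x) − ∫ g dπ| ≤ 2 C_g A ρ^t` for every bounded measurable `g` (`|g| ≤ C_g`),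
every `x`, `t` (`0 ≤ A`, `0 ≤ ρ < 1`) — the consequence of every Doeblin certificate of the venture,
one-step (`A = 1`, `ρ = 1 − ε`) or `m`-step (`Scoring/DoeblinPowerGeometricEnvelope.lean`); `|f| ≤ C`
measurable, `f̄ = f − πf`, `σ²_f = ∫ f̄² dπ + 2 Σ_{k≥1} ∫ f̄ (kop κ)^[k] f̄ dπ` the Green–Kubo variance
written as in `Scoring/MarkovChainCLT.lean`.  GEN-19 proved the statements below under a ONE-step
minorisation (`Scoring/ChainBlockSumMoments.lean`, Poisson solution `|h| ≤ 4C/e` from the residual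
kernel); here the Poisson solution `h = Σ_t (kop κ)^[t] f̄` comes from the envelope by row 13's
Neumann-series lemma (`Exactness.GeneralNCMC.poisson_exists_of_envelope`: `|h| ≤ C_h := 4 C A/(1−ρ)`),
the identity `π(kop κ (h²) − (kop κ h)²) = σ²_f` from row 13's martingale form of the asymptotic
variance (`Exactness.GeneralNCMC.integral_sq_sub_sq_kop_eq_greenKubo`, any summable decay rate), and
GEN-19's kernel-generic Poisson–martingale moment bounds (`Scoring/ChainMartingaleFourthMoment.lean`,
`Scoring/ChainMartingaleIncrements.lean`) do the rest verbatim.  These are the moment inputs of the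
consistency of the batch-means estimator under a Doeblin power
(`Scoring/BatchMeansCovarianceEnvelope.lean`, `Scoring/BatchMeansConsistencyEnvelope.lean`).
Printed counterparts NAMED ONLY: the Poisson-equation form of the asymptotic variance
`σ²_f = π(h²) − π((Ph)²)` (Meyn–Tweedie 1993 Thm 17.4.4).

## Content (envelope `(A, ρ)`, `π` invariant; `P_{μ₀}` the chain's path law from ANY `μ₀`)

* `decay_of_geometricEnvelope` — the centred decay shape `|(kop κ)^[t] g| ≤ 2 C_g (A ρ^t)` used by
  row 13's envelope lemmas; **`poisson_exists_of_geometricEnvelope`** — a measurable `h` with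
  `|h| ≤ 4 C A/(1−ρ)` and `h − kop κ h = f̄`;
* **`abs_chain_blockMartingale_sq_sub_le_of_envelope`** — `|h| ≤ C_h` measurable,
  `q = kop κ (h²) − (kop κ h)²`: `|E_{μ₀}[M_{s,n}²] − n π(q)| ≤ 2 C_h² A/(1−ρ)`;
* **`poisson_condVar_integral_eq_greenKubo_of_envelope`** — for any bounded measurable `h` with
  `h − kop κ h = f̄`: `π(q) = σ²_f`;
* **`chain_blockSum_fourth_le_of_envelope`** (`≤ 512 C_h⁴ n²`), **`chain_blockSum_sq_le_of_envelope`**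
  (`≤ 10 C_h² n`), **`abs_chain_blockSum_sq_sub_le_of_envelope`**
  (`|E_{μ₀}[S_{s,n}²] − n σ²_f| ≤ C_h² (2A/(1−ρ) + 4 + 4√n)`), all with `C_h = 4 C A/(1−ρ)`, uniformly
  in the initial law and the block position;
* **`greenKubo_nonneg_of_envelope`**, **`greenKubo_le_of_envelope`** — `0 ≤ σ²_f ≤ C_h²`.

NOT CLAIMED: sharp constants; unbounded observables; any `A, ρ` of a concrete sampler.
-/

noncomputable section

namespace Summit.Ventures.LatticeQCDFlow.Scoring

open MeasureTheory ProbabilityTheory Filter Finset Preorder Literature.Probability.MarkovChains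
open scoped ENNReal Topology

variable {Ω : Type*} [MeasurableSpace Ω]

section Envelope

variable {κ : Kernel Ω Ω} [IsMarkovKernel κ] {π : Measure Ω} [IsProbabilityMeasure π] {A ρ : ℝ}

omit [IsMarkovKernel κ] [IsProbabilityMeasure π] in
/-- The centred decay shape consumed by row 13's envelope lemmas: for `π`-centred bounded `g`,
`|(kop κ)^[t] g x| ≤ 2 C_g (A ρ^t)`. -/
theorem decay_of_geometricEnvelope
    (henv : ∀ (g : Ω → ℝ), Measurable g → ∀ (Cg : ℝ), (∀ x, |g x| ≤ Cg) →
      ∀ (t : ℕ) (x : Ω), |(kop κ)^[t] g x - ∫ y, g y ∂π| ≤ 2 * Cg * (A * ρ ^ t)) :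
    ∀ (g : Ω → ℝ), Measurable g → ∀ (Cg : ℝ), (∀ x, |g x| ≤ Cg) → ∫ x, g x ∂π = 0 →
      ∀ (t : ℕ) (x : Ω), |(kop κ)^[t] g x| ≤ 2 * Cg * (A * ρ ^ t) := by
  intro g hg Cg hCg hg0 t x
  have h := henv g hg Cg hCg t x
  rwa [hg0, sub_zero] at h

/-- **A bounded Poisson solution from the envelope**: for `0 ≤ ρ < 1` and `|f| ≤ C` measurable there
is a measurable `h` with `|h| ≤ 4 C A/(1−ρ)` and `h − kop κ h = f − πf`. -/
theorem poisson_exists_of_geometricEnvelope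
    (henv : ∀ (g : Ω → ℝ), Measurable g → ∀ (Cg : ℝ), (∀ x, |g x| ≤ Cg) →
      ∀ (t : ℕ) (x : Ω), |(kop κ)^[t] g x - ∫ y, g y ∂π| ≤ 2 * Cg * (A * ρ ^ t))
    (hρ0 : 0 ≤ ρ) (hρ1 : ρ < 1) {f : Ω → ℝ} (hf : Measurable f) {C : ℝ} (hC : ∀ x, |f x| ≤ C) :
    ∃ h : Ω → ℝ, Measurable h ∧ (∀ x, |h x| ≤ 4 * C * A / (1 - ρ)) ∧
      ∀ x, h x - kop κ h x = f x - ∫ z, f z ∂π := by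
  obtain ⟨hfb, hCfb, hfb0⟩ := centred_observable_bounds π hf hC
  have hsum : Summable fun t : ℕ => 2 * (2 * C) * (A * ρ ^ t) :=
    ((summable_geometric_of_lt_one hρ0 hρ1).mul_left A).mul_left (2 * (2 * C))
  have hdecay : ∀ (t : ℕ) (x : Ω), |(kop κ)^[t] (fun y => f y - ∫ z, f z ∂π) x|
      ≤ 2 * (2 * C) * (A * ρ ^ t) :=
    decay_of_geometricEnvelope henv _ hfb (2 * C) hCfb hfb0
  obtain ⟨h, hhm, hhb, hpois⟩ :=
    Exactness.GeneralNCMC.poisson_exists_of_envelope (κ := κ) hfb hCfb hsum hdecay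
  refine ⟨h, hhm, fun x => (hhb x).trans (le_of_eq ?_), hpois⟩
  rw [tsum_mul_left, tsum_mul_left, tsum_geometric_of_lt_one hρ0 hρ1]
  field_simp
  ring

omit [IsProbabilityMeasure π] in
/-- **`|E_{μ₀}[M_{s,n}²] − n π(q)| ≤ 2 C_h² A/(1−ρ)`**: the block martingale's second moment is
`n π(q)` up to a bounded error, uniformly in `s` and the initial law (`0 ≤ A`, `0 ≤ ρ < 1`,
`|h| ≤ C_h` measurable, `q = kop κ (h²) − (kop κ h)²`). -/
theorem abs_chain_blockMartingale_sq_sub_le_of_envelope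
    (henv : ∀ (g : Ω → ℝ), Measurable g → ∀ (Cg : ℝ), (∀ x, |g x| ≤ Cg) →
      ∀ (t : ℕ) (x : Ω), |(kop κ)^[t] g x - ∫ y, g y ∂π| ≤ 2 * Cg * (A * ρ ^ t))
    (hA : 0 ≤ A) (hρ0 : 0 ≤ ρ) (hρ1 : ρ < 1)
    {h : Ω → ℝ} (hh : Measurable h) {Ch : ℝ} (hCh : ∀ x, |h x| ≤ Ch)
    (μ₀ : Measure Ω) [IsProbabilityMeasure μ₀] (s n : ℕ) :
    |∫ x, (∑ t ∈ Finset.range n, (h (x (s + t + 1)) - kop κ h (x (s + t)))) ^ 2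
        ∂(Kernel.trajMeasure (X := fun _ : ℕ => Ω) μ₀
          (fun n : ℕ => κ.comap (fun h : (i : ↥(Finset.Iic n)) → Ω => h ⟨n, Finset.mem_Iic.2 le_rfl⟩)
            (measurable_pi_apply _)))
      - n * ∫ y, (kop κ (fun z => h z ^ 2) y - (kop κ h y) ^ 2) ∂π|
      ≤ 2 * Ch ^ 2 * A / (1 - ρ) := by
  obtain ⟨hqm, hqb⟩ := kopCondVar_bounded_measurable κ hh hCh
  set q : Ω → ℝ := fun y => kop κ (fun z => h z ^ 2) y - (kop κ h y) ^ 2 with hq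
  set m : ℝ := ∫ y, q y ∂π with hm
  -- `E[q(X_u)] − m = ∫ (K^u q − m) dμ₀`, bounded by `2 C_h² A ρ^u`
  have hstep : ∀ u : ℕ, |∫ x, q (x u) ∂(Kernel.trajMeasure (X := fun _ : ℕ => Ω) μ₀
      (fun n : ℕ => κ.comap (fun h : (i : ↥(Finset.Iic n)) → Ω => h ⟨n, Finset.mem_Iic.2 le_rfl⟩)
        (measurable_pi_apply _))) - m| ≤ 2 * Ch ^ 2 * (A * ρ ^ u) := by
    intro u
    obtain ⟨hKm, hKb⟩ := iterate_kop_bounded_measurable κ hqm hqb u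
    have h1 : ∫ x, q (x u) ∂(Kernel.trajMeasure (X := fun _ : ℕ => Ω) μ₀
        (fun n : ℕ => κ.comap (fun h : (i : ↥(Finset.Iic n)) → Ω => h ⟨n, Finset.mem_Iic.2 le_rfl⟩)
          (measurable_pi_apply _))) - m
        = ∫ y, ((kop κ)^[u] q y - m) ∂μ₀ := by
      rw [chain_expect κ μ₀ hqm hqb u,
        integral_sub (integrable_of_bounded μ₀ hKm hKb) (integrable_const _), integral_const,
        probReal_univ, one_smul]
    rw [h1]
    calc |∫ y, ((kop κ)^[u] q y - m) ∂μ₀| = ‖∫ y, ((kop κ)^[u] q y - m) ∂μ₀‖ :=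
          (Real.norm_eq_abs _).symm
      _ ≤ 2 * Ch ^ 2 * (A * ρ ^ u) * μ₀.real Set.univ :=
          norm_integral_le_of_norm_le_const (Eventually.of_forall fun y => by
            rw [Real.norm_eq_abs]
            exact henv q hqm (Ch ^ 2) hqb u y)
      _ = 2 * Ch ^ 2 * (A * ρ ^ u) := by rw [probReal_univ, mul_one]
  rw [chain_blockMartingale_sq_eq κ μ₀ hh hCh s n]
  have hsum : (n : ℝ) * m = ∑ t ∈ Finset.range n, m := by
    rw [Finset.sum_const, Finset.card_range, nsmul_eq_mul]
  rw [hsum, ← Finset.sum_sub_distrib]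
  calc |∑ t ∈ Finset.range n, (∫ x, q (x (s + t)) ∂(Kernel.trajMeasure (X := fun _ : ℕ => Ω) μ₀
        (fun n : ℕ => κ.comap (fun h : (i : ↥(Finset.Iic n)) → Ω => h ⟨n, Finset.mem_Iic.2 le_rfl⟩)
          (measurable_pi_apply _))) - m)|
      ≤ ∑ t ∈ Finset.range n, |∫ x, q (x (s + t)) ∂(Kernel.trajMeasure (X := fun _ : ℕ => Ω) μ₀
        (fun n : ℕ => κ.comap (fun h : (i : ↥(Finset.Iic n)) → Ω => h ⟨n, Finset.mem_Iic.2 le_rfl⟩)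
          (measurable_pi_apply _))) - m| := Finset.abs_sum_le_sum_abs _ _
    _ ≤ ∑ t ∈ Finset.range n, 2 * Ch ^ 2 * (A * ρ ^ (s + t)) :=
        Finset.sum_le_sum fun t _ => hstep (s + t)
    _ ≤ ∑ t ∈ Finset.range n, 2 * Ch ^ 2 * A * ρ ^ t := by
        refine Finset.sum_le_sum fun t _ => ?_
        rw [← mul_assoc, pow_add]
        exact mul_le_mul_of_nonneg_left (mul_le_of_le_one_left (pow_nonneg hρ0 t)
          (pow_le_one₀ hρ0 hρ1.le)) (by positivity)
    _ ≤ 2 * Ch ^ 2 * A / (1 - ρ) := by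
        have hgeo : HasSum (fun t : ℕ => 2 * Ch ^ 2 * A * ρ ^ t) (2 * Ch ^ 2 * A / (1 - ρ)) := by
          have hg := (hasSum_geometric_of_lt_one hρ0 hρ1).mul_left (2 * Ch ^ 2 * A)
          rwa [← div_eq_mul_inv] at hg
        exact sum_le_hasSum _ (fun t _ => by positivity) hgeo

/-- **THE `π`-MEAN OF THE CONDITIONAL VARIANCE IS THE GREEN–KUBO VARIANCE**, under the envelope
(`0 ≤ ρ < 1`, `π` invariant): for `|f| ≤ C` measurable, `f̄ = f − πf`, and `h` ANY bounded measurable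
solution of `h − kop κ h = f̄`,
`∫ (kop κ (h²) − (kop κ h)²) dπ = ∫ f̄² dπ + 2 Σ_{k≥0} ∫ f̄ · (kop κ)^[k+1] f̄ dπ`. -/
theorem poisson_condVar_integral_eq_greenKubo_of_envelope (hπ : Kernel.Invariant κ π)
    (henv : ∀ (g : Ω → ℝ), Measurable g → ∀ (Cg : ℝ), (∀ x, |g x| ≤ Cg) →
      ∀ (t : ℕ) (x : Ω), |(kop κ)^[t] g x - ∫ y, g y ∂π| ≤ 2 * Cg * (A * ρ ^ t))
    (hρ0 : 0 ≤ ρ) (hρ1 : ρ < 1)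
    {f : Ω → ℝ} (hf : Measurable f) {C : ℝ} (hC : ∀ x, |f x| ≤ C)
    {h : Ω → ℝ} (hh : Measurable h) {Ch : ℝ} (hCh : ∀ x, |h x| ≤ Ch)
    (hpois : ∀ y, h y - kop κ h y = f y - ∫ z, f z ∂π) :
    ∫ y, (kop κ (fun z => h z ^ 2) y - (kop κ h y) ^ 2) ∂π
      = (∫ y, (f y - ∫ z, f z ∂π) ^ 2 ∂π)
        + 2 * ∑' k, ∫ y, (f y - ∫ z, f z ∂π) * (kop κ)^[k + 1] (fun y => f y - ∫ z, f z ∂π) y ∂π := by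
  obtain ⟨hfb, hCfb, hfb0⟩ := centred_observable_bounds π hf hC
  have hr : Summable fun t : ℕ => A * ρ ^ t := (summable_geometric_of_lt_one hρ0 hρ1).mul_left A
  have hmart := Exactness.GeneralNCMC.integral_sq_sub_sq_kop_eq_greenKubo (κ := κ) (π := π) hr
    (decay_of_geometricEnvelope henv) hfb hCfb hfb0 hh hCh hpois
  -- `∫ K(h²) dπ = ∫ h² dπ` (invariance)
  have hh2 : Measurable fun y => h y ^ 2 := hh.pow_const 2
  have hCh2 : ∀ y, |h y ^ 2| ≤ Ch ^ 2 := fun y => by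
    rw [abs_pow]; exact pow_le_pow_left₀ (abs_nonneg _) (hCh y) 2
  have hK2 : ∫ y, kop κ (fun z => h z ^ 2) y ∂π = ∫ y, h y ^ 2 ∂π := integral_kop κ hπ hh2 hCh2
  have hiK2 : Integrable (fun y => kop κ (fun z => h z ^ 2) y) π :=
    integrable_of_bounded π (measurable_kop κ hh2) (abs_kop_le κ hCh2)
  have hiKh2 : Integrable (fun y => (kop κ h y) ^ 2) π :=
    integrable_of_bounded π ((measurable_kop κ hh).pow_const 2) (C := Ch ^ 2) fun y => by
      rw [abs_pow]; exact pow_le_pow_left₀ (abs_nonneg _) (abs_kop_le κ hCh y) 2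
  rw [integral_sub hiK2 hiKh2, hK2, hmart]
  rfl

/-- **THE FOURTH-MOMENT BOUND FOR BLOCK SUMS UNDER THE ENVELOPE, FROM ANY START.**  `π` invariant,
envelope `(A, ρ)` (`0 ≤ ρ < 1`), `|f| ≤ C` measurable.  For EVERY initial law `μ₀`, every `s` and every
`n ≥ 1`: `E_{μ₀}[(Σ_{t<n} (f(X_{s+t}) − πf))⁴] ≤ 512 (4CA/(1−ρ))⁴ n²`. -/
theorem chain_blockSum_fourth_le_of_envelope
    (henv : ∀ (g : Ω → ℝ), Measurable g → ∀ (Cg : ℝ), (∀ x, |g x| ≤ Cg) →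
      ∀ (t : ℕ) (x : Ω), |(kop κ)^[t] g x - ∫ y, g y ∂π| ≤ 2 * Cg * (A * ρ ^ t))
    (hρ0 : 0 ≤ ρ) (hρ1 : ρ < 1)
    {f : Ω → ℝ} (hf : Measurable f) {C : ℝ} (hC : ∀ x, |f x| ≤ C)
    (μ₀ : Measure Ω) [IsProbabilityMeasure μ₀] (s : ℕ) {n : ℕ} (hn : n ≠ 0) :
    ∫ x, (∑ t ∈ Finset.range n, (f (x (s + t)) - ∫ z, f z ∂π)) ^ 4
        ∂(Kernel.trajMeasure (X := fun _ : ℕ => Ω) μ₀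
          (fun n : ℕ => κ.comap (fun h : (i : ↥(Finset.Iic n)) → Ω => h ⟨n, Finset.mem_Iic.2 le_rfl⟩)
            (measurable_pi_apply _)))
      ≤ 512 * (4 * C * A / (1 - ρ)) ^ 4 * (n : ℝ) ^ 2 := by
  obtain ⟨hfb, -, -⟩ := centred_observable_bounds π hf hC
  obtain ⟨h, hh, hCh, hpois⟩ := poisson_exists_of_geometricEnvelope henv hρ0 hρ1 hf hC
  exact chain_blockSum_fourth_le_of_poisson κ μ₀ hh hCh hfb hpois s hn

/-- **Second moment of block sums under the envelope, any start** (same hypotheses):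
`E_{μ₀}[(Σ_{t<n} (f(X_{s+t}) − πf))²] ≤ 10 (4CA/(1−ρ))² n`. -/
theorem chain_blockSum_sq_le_of_envelope
    (henv : ∀ (g : Ω → ℝ), Measurable g → ∀ (Cg : ℝ), (∀ x, |g x| ≤ Cg) →
      ∀ (t : ℕ) (x : Ω), |(kop κ)^[t] g x - ∫ y, g y ∂π| ≤ 2 * Cg * (A * ρ ^ t))
    (hρ0 : 0 ≤ ρ) (hρ1 : ρ < 1)
    {f : Ω → ℝ} (hf : Measurable f) {C : ℝ} (hC : ∀ x, |f x| ≤ C)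
    (μ₀ : Measure Ω) [IsProbabilityMeasure μ₀] (s : ℕ) {n : ℕ} (hn : n ≠ 0) :
    ∫ x, (∑ t ∈ Finset.range n, (f (x (s + t)) - ∫ z, f z ∂π)) ^ 2
        ∂(Kernel.trajMeasure (X := fun _ : ℕ => Ω) μ₀
          (fun n : ℕ => κ.comap (fun h : (i : ↥(Finset.Iic n)) → Ω => h ⟨n, Finset.mem_Iic.2 le_rfl⟩)
            (measurable_pi_apply _)))
      ≤ 10 * (4 * C * A / (1 - ρ)) ^ 2 * n := by
  obtain ⟨hfb, -, -⟩ := centred_observable_bounds π hf hC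
  obtain ⟨h, hh, hCh, hpois⟩ := poisson_exists_of_geometricEnvelope henv hρ0 hρ1 hf hC
  exact chain_blockSum_sq_le_of_poisson κ μ₀ hh hCh hfb hpois s hn

/-- **THE SECOND MOMENT OF A BLOCK SUM IS `n σ²_f + O(√n)`, UNIFORMLY IN THE START AND THE BLOCK
POSITION, UNDER THE ENVELOPE.**  `π` invariant, envelope `(A, ρ)` (`0 ≤ A`, `0 ≤ ρ < 1`), `|f| ≤ C`
measurable, `C_h = 4CA/(1−ρ)`; for EVERY `μ₀`, `s`, `n`:
`|E_{μ₀}[(Σ_{t<n} (f(X_{s+t}) − πf))²] − n σ²_f| ≤ C_h² (2A/(1−ρ) + 4 + 4√n)`. -/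
theorem abs_chain_blockSum_sq_sub_le_of_envelope (hπ : Kernel.Invariant κ π)
    (henv : ∀ (g : Ω → ℝ), Measurable g → ∀ (Cg : ℝ), (∀ x, |g x| ≤ Cg) →
      ∀ (t : ℕ) (x : Ω), |(kop κ)^[t] g x - ∫ y, g y ∂π| ≤ 2 * Cg * (A * ρ ^ t))
    (hA : 0 ≤ A) (hρ0 : 0 ≤ ρ) (hρ1 : ρ < 1)
    {f : Ω → ℝ} (hf : Measurable f) {C : ℝ} (hC : ∀ x, |f x| ≤ C)
    (μ₀ : Measure Ω) [IsProbabilityMeasure μ₀] (s n : ℕ) :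
    |∫ x, (∑ t ∈ Finset.range n, (f (x (s + t)) - ∫ z, f z ∂π)) ^ 2
        ∂(Kernel.trajMeasure (X := fun _ : ℕ => Ω) μ₀
          (fun n : ℕ => κ.comap (fun h : (i : ↥(Finset.Iic n)) → Ω => h ⟨n, Finset.mem_Iic.2 le_rfl⟩)
            (measurable_pi_apply _)))
      - n * ((∫ y, (f y - ∫ z, f z ∂π) ^ 2 ∂π)
        + 2 * ∑' k, ∫ y, (f y - ∫ z, f z ∂π) * (kop κ)^[k + 1] (fun y => f y - ∫ z, f z ∂π) y ∂π)|
      ≤ (4 * C * A / (1 - ρ)) ^ 2 * (2 * A / (1 - ρ) + 4 + 4 * Real.sqrt n) := by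
  set P := Kernel.trajMeasure (X := fun _ : ℕ => Ω) μ₀
      (fun n : ℕ => κ.comap (fun h : (i : ↥(Finset.Iic n)) → Ω => h ⟨n, Finset.mem_Iic.2 le_rfl⟩)
        (measurable_pi_apply _)) with hP
  obtain ⟨hfb, hCfb, hfb0⟩ := centred_observable_bounds π hf hC
  obtain ⟨h, hh, hCh', hpois⟩ := poisson_exists_of_geometricEnvelope henv hρ0 hρ1 hf hC
  set Ch : ℝ := 4 * C * A / (1 - ρ) with hChdef
  have hCh0 : 0 ≤ Ch := (abs_nonneg _).trans (hCh' (Classical.choice (nonempty_of_isProbabilityMeasure π)))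
  have h1ρ : 0 < 1 - ρ := sub_pos.2 hρ1
  set c := ∫ z, f z ∂π with hc
  -- `σ²_f = π(q)`
  rw [← poisson_condVar_integral_eq_greenKubo_of_envelope hπ henv hρ0 hρ1 hf hC hh hCh' hpois]
  -- the martingale part
  set M : (ℕ → Ω) → ℝ := fun x =>
    ∑ t ∈ Finset.range n, (h (x (s + t + 1)) - kop κ h (x (s + t))) with hMdef
  have hMm : Measurable M := blockMartingale_measurable κ hh s n
  have hMb : ∀ x, |M x| ≤ n * (2 * Ch) := abs_blockMartingale_le κ hCh' s n
  have hM2 : ∫ x, M x ^ 2 ∂P ≤ n * Ch ^ 2 := chain_blockMartingale_sq_le κ μ₀ hh hCh' s n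
  have hMσ := abs_chain_blockMartingale_sq_sub_le_of_envelope henv hA hρ0 hρ1 hh hCh' μ₀ s n
  rw [← hP] at hMσ
  -- `E|M| ≤ √n C_h`
  have hiM : Integrable M P := integrable_of_bounded P hMm hMb
  have hEabsM : ∫ x, |M x| ∂P ≤ Real.sqrt n * Ch := by
    have hJ := sq_integral_le_integral_sq P (hMm.abs) (C := n * (2 * Ch)) (fun x => by
      rw [abs_abs]; exact hMb x)
    have hJ' : (∫ x, |M x| ∂P) ^ 2 ≤ n * Ch ^ 2 := by
      refine hJ.trans ?_
      rw [show (fun x => |M x| ^ 2) = fun x => M x ^ 2 from funext fun x => sq_abs _]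
      exact hM2
    calc ∫ x, |M x| ∂P ≤ Real.sqrt (n * Ch ^ 2) := Real.le_sqrt_of_sq_le hJ'
      _ = Real.sqrt n * Ch := by rw [Real.sqrt_mul (Nat.cast_nonneg n), Real.sqrt_sq hCh0]
  -- `S = M + Δ`, `|Δ| ≤ 2 C_h`
  have hΔb : ∀ x : ℕ → Ω, |h (x s) - h (x (s + n))| ≤ 2 * Ch := fun x =>
    (abs_sub _ _).trans (by linarith [hCh' (x s), hCh' (x (s + n))])
  have hΔm : Measurable fun x : ℕ → Ω => h (x s) - h (x (s + n)) :=
    (hh.comp (measurable_pi_apply _)).sub (hh.comp (measurable_pi_apply _))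
  have hS : ∀ x : ℕ → Ω, (∑ t ∈ Finset.range n, (f (x (s + t)) - c)) ^ 2
      = M x ^ 2 + (2 * M x * (h (x s) - h (x (s + n))) + (h (x s) - h (x (s + n))) ^ 2) := fun x => by
    rw [blockSum_eq_blockMartingale_add (kop κ) hpois s n x]
    ring
  have hiM2 : Integrable (fun x => M x ^ 2) P :=
    integrable_of_bounded P (hMm.pow_const 2) (C := (n * (2 * Ch)) ^ 2) fun x => by
      rw [abs_pow]; exact pow_le_pow_left₀ (abs_nonneg _) (hMb x) 2
  have hrest_m : Measurable fun x : ℕ → Ω =>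
      2 * M x * (h (x s) - h (x (s + n))) + (h (x s) - h (x (s + n))) ^ 2 :=
    ((hMm.const_mul 2).mul hΔm).add (hΔm.pow_const 2)
  have hrest_b : ∀ x : ℕ → Ω, |2 * M x * (h (x s) - h (x (s + n))) + (h (x s) - h (x (s + n))) ^ 2|
      ≤ 2 * (2 * Ch) * |M x| + (2 * Ch) ^ 2 := fun x => by
    refine (abs_add_le _ _).trans (add_le_add ?_ ?_)
    · calc |2 * M x * (h (x s) - h (x (s + n)))| = 2 * |M x| * |h (x s) - h (x (s + n))| := by
            rw [abs_mul, abs_mul, abs_two]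
        _ ≤ 2 * |M x| * (2 * Ch) :=
            mul_le_mul_of_nonneg_left (hΔb x) (mul_nonneg zero_le_two (abs_nonneg _))
        _ = 2 * (2 * Ch) * |M x| := by ring
    · rw [abs_pow]; exact pow_le_pow_left₀ (abs_nonneg _) (hΔb x) 2
  have h4Ch : 0 ≤ 2 * (2 * Ch) := by positivity
  have hirest : Integrable (fun x : ℕ → Ω =>
      2 * M x * (h (x s) - h (x (s + n))) + (h (x s) - h (x (s + n))) ^ 2) P :=
    integrable_of_bounded P hrest_m (C := 2 * (2 * Ch) * (n * (2 * Ch)) + (2 * Ch) ^ 2) fun x =>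
      (hrest_b x).trans (add_le_add_left (mul_le_mul_of_nonneg_left (hMb x) h4Ch) _)
  have hiAbsM : Integrable (fun x => 2 * (2 * Ch) * |M x|) P := hiM.abs.const_mul _
  have hiAbsM' : Integrable (fun x => 2 * (2 * Ch) * |M x| + (2 * Ch) ^ 2) P :=
    hiAbsM.add (integrable_const _)
  have hErest : |∫ x, (2 * M x * (h (x s) - h (x (s + n))) + (h (x s) - h (x (s + n))) ^ 2) ∂P|
      ≤ 2 * (2 * Ch) * (Real.sqrt n * Ch) + (2 * Ch) ^ 2 := by
    calc |∫ x, (2 * M x * (h (x s) - h (x (s + n))) + (h (x s) - h (x (s + n))) ^ 2) ∂P|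
        ≤ ∫ x, |2 * M x * (h (x s) - h (x (s + n))) + (h (x s) - h (x (s + n))) ^ 2| ∂P :=
          abs_integral_le_integral_abs
      _ ≤ ∫ x, (2 * (2 * Ch) * |M x| + (2 * Ch) ^ 2) ∂P :=
          integral_mono_of_nonneg (ae_of_all _ fun x => abs_nonneg _) hiAbsM' (ae_of_all _ hrest_b)
      _ = 2 * (2 * Ch) * ∫ x, |M x| ∂P + (2 * Ch) ^ 2 := by
          rw [integral_add hiAbsM (integrable_const _), integral_const_mul,
            integral_const, smul_eq_mul, probReal_univ, one_mul]
      _ ≤ 2 * (2 * Ch) * (Real.sqrt n * Ch) + (2 * Ch) ^ 2 :=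
          add_le_add_left (mul_le_mul_of_nonneg_left hEabsM h4Ch) _
  have hsplit : ∫ x, (∑ t ∈ Finset.range n, (f (x (s + t)) - c)) ^ 2 ∂P
      = ∫ x, M x ^ 2 ∂P
        + ∫ x, (2 * M x * (h (x s) - h (x (s + n))) + (h (x s) - h (x (s + n))) ^ 2) ∂P := by
    rw [integral_congr_ae (ae_of_all _ hS), integral_add hiM2 hirest]
  rw [hsplit]
  have hsq0 : 0 ≤ Real.sqrt n := Real.sqrt_nonneg _
  calc |∫ x, M x ^ 2 ∂P
        + ∫ x, (2 * M x * (h (x s) - h (x (s + n))) + (h (x s) - h (x (s + n))) ^ 2) ∂P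
        - n * ∫ y, (kop κ (fun z => h z ^ 2) y - (kop κ h y) ^ 2) ∂π|
      ≤ |∫ x, M x ^ 2 ∂P - n * ∫ y, (kop κ (fun z => h z ^ 2) y - (kop κ h y) ^ 2) ∂π|
        + |∫ x, (2 * M x * (h (x s) - h (x (s + n))) + (h (x s) - h (x (s + n))) ^ 2) ∂P| := by
        rw [show ∫ x, M x ^ 2 ∂P
          + ∫ x, (2 * M x * (h (x s) - h (x (s + n))) + (h (x s) - h (x (s + n))) ^ 2) ∂P
          - n * ∫ y, (kop κ (fun z => h z ^ 2) y - (kop κ h y) ^ 2) ∂π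
          = (∫ x, M x ^ 2 ∂P - n * ∫ y, (kop κ (fun z => h z ^ 2) y - (kop κ h y) ^ 2) ∂π)
            + ∫ x, (2 * M x * (h (x s) - h (x (s + n))) + (h (x s) - h (x (s + n))) ^ 2) ∂P by ring]
        exact abs_add_le _ _
    _ ≤ 2 * Ch ^ 2 * A / (1 - ρ) + (2 * (2 * Ch) * (Real.sqrt n * Ch) + (2 * Ch) ^ 2) :=
        add_le_add hMσ hErest
    _ = Ch ^ 2 * (2 * A / (1 - ρ) + 4 + 4 * Real.sqrt n) := by
        field_simp
        ring

/-- **`0 ≤ σ²_f`** under the envelope (`π` invariant, `0 ≤ ρ < 1`): the Green–Kubo variance is the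
`π`-mean of a pointwise nonnegative conditional variance. -/
theorem greenKubo_nonneg_of_envelope (hπ : Kernel.Invariant κ π)
    (henv : ∀ (g : Ω → ℝ), Measurable g → ∀ (Cg : ℝ), (∀ x, |g x| ≤ Cg) →
      ∀ (t : ℕ) (x : Ω), |(kop κ)^[t] g x - ∫ y, g y ∂π| ≤ 2 * Cg * (A * ρ ^ t))
    (hρ0 : 0 ≤ ρ) (hρ1 : ρ < 1) {f : Ω → ℝ} (hf : Measurable f) {C : ℝ} (hC : ∀ x, |f x| ≤ C) :
    0 ≤ (∫ y, (f y - ∫ z, f z ∂π) ^ 2 ∂π)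
        + 2 * ∑' k, ∫ y, (f y - ∫ z, f z ∂π) * (kop κ)^[k + 1] (fun y => f y - ∫ z, f z ∂π) y ∂π := by
  obtain ⟨h, hh, hCh, hpois⟩ := poisson_exists_of_geometricEnvelope henv hρ0 hρ1 hf hC
  rw [← poisson_condVar_integral_eq_greenKubo_of_envelope hπ henv hρ0 hρ1 hf hC hh hCh hpois]
  exact integral_nonneg fun y => kopCondVar_nonneg κ hh hCh y

/-- **`σ²_f ≤ (4CA/(1−ρ))²`** under the envelope (`π` invariant, `0 ≤ ρ < 1`). -/
theorem greenKubo_le_of_envelope (hπ : Kernel.Invariant κ π)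
    (henv : ∀ (g : Ω → ℝ), Measurable g → ∀ (Cg : ℝ), (∀ x, |g x| ≤ Cg) →
      ∀ (t : ℕ) (x : Ω), |(kop κ)^[t] g x - ∫ y, g y ∂π| ≤ 2 * Cg * (A * ρ ^ t))
    (hρ0 : 0 ≤ ρ) (hρ1 : ρ < 1) {f : Ω → ℝ} (hf : Measurable f) {C : ℝ} (hC : ∀ x, |f x| ≤ C) :
    (∫ y, (f y - ∫ z, f z ∂π) ^ 2 ∂π)
        + 2 * ∑' k, ∫ y, (f y - ∫ z, f z ∂π) * (kop κ)^[k + 1] (fun y => f y - ∫ z, f z ∂π) y ∂π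
      ≤ (4 * C * A / (1 - ρ)) ^ 2 := by
  obtain ⟨h, hh, hCh, hpois⟩ := poisson_exists_of_geometricEnvelope henv hρ0 hρ1 hf hC
  rw [← poisson_condVar_integral_eq_greenKubo_of_envelope hπ henv hρ0 hρ1 hf hC hh hCh hpois]
  calc ∫ y, (kop κ (fun z => h z ^ 2) y - (kop κ h y) ^ 2) ∂π
      ≤ ∫ y, (4 * C * A / (1 - ρ)) ^ 2 ∂π :=
        integral_mono_of_nonneg (ae_of_all _ fun y => kopCondVar_nonneg κ hh hCh y)
          (integrable_const _) (ae_of_all _ fun y => kopCondVar_le κ hCh y)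
    _ = (4 * C * A / (1 - ρ)) ^ 2 := by rw [integral_const, probReal_univ, one_smul]

end Envelope

end Summit.Ventures.LatticeQCDFlow.Scoring

end
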